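import Summits.Parity.GeneralizedHardyLittlewood.Theorems.PrimeLevelFamEdgeMomentsBeyondDiagonalDiagRemThreeThreeKernelsAll
import Summits.Parity.GeneralizedHardyLittlewood.Theorems.PrimeLevelFamEdgeMomentsBeyondDiagonalDiagRemZeroFourBose
import Summits.Parity.GeneralizedHardyLittlewood.Theorems.PrimeLevelFamEdgeMomentsBeyondDiagonalDiagRemTwoFourBose
import HarnessLib

/-!
# Route `PrimeLevelFamEdge`, crux K_A `MomentsBeyondDiagonal` (stmt-Parity-20007), line «petersson_layers» v4, stub `stub_diag`:
# **the fifteen remainder kernels of ORDER `(2,4)` under one constant, with the pointwise bounds of the six both-sided ones**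
# (brick B4b of the remainder estimate (R₂₄))

(R₂₄) — the hypothesis `hR` of `…DiagOrderTwoFourOfR24.orderTwoFour_target_of_remainder` (lineage famedge-2 g7) — carries the
fifteen continued Bose remainders `r_ab`, `a ≤ 2`, `b ≤ 4`, in `Π`-form. Twelve of them (`a ≤ 2`, `b ≤ 3`) are bundled in
`…DiagRemThreeThreeKernelsAll.twoSeq_sixteen₃₃` (p834064), `r₀₄` is `…DiagRemZeroFourBose.abs_doubleSum_rem_le₀₄b` (this lineage,
envelope `x⁶ ≤ x⁸`), `r₁₄, r₂₄` are `…DiagRemTwoFourBose.abs_doubleSum_rem_le₂₄b`. This file is the order-`(2,4)` twin of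
`twoSeq_sixteen₃₃`:

* `twoSeq_envelope_mono68` — the envelope `9C'x⁶` is below `9Cx⁸` for `1 ≤ x`, `C' ≤ C`;
* `twoSeq_fifteen₂₄` — **all fifteen kernels of (R₂₄) under ONE `C₀` (two-sequence Abel estimate, envelope `9C₀(1+|log 2αY²|)⁸`)
  and, with the same `E_ab`, the pointwise bounds `|r_ab(y)| ≤ C₀√y` (`0 < y ≤ 1`), `|r_ab(y)| ≤ C₀(1+log y)³` (`y ≥ 1`) of the six
  both-sided kernels `r₀₀, r₀₁, r₁₀, r₀₂, r₂₀, r₁₁`** — the kernel input of the (3,3)-shaped inner estimate of (R₂₄).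

Def-free; theorems only. Helper `--supports stmt-Parity-20007`; closes nothing (bricks B3–B5 of (R₂₄), the order `(4,4)` and
`stub_rung/core/band/farP` remain); K_A, K_B and the Parity summit are NOT proved; nothing about Landau–Siegel zeros.

## References
* E. Kowalski, P. Michel, J. VanderKam, J. reine angew. Math. 526 (2000), (22)–(28) pp. 12–15 and Prop. 5.1 p. 18.
  [cite: KowalskiMichelVanderKam2000, (23)–(28) and Prop. 5.1 — derivation (order-(2,4) remainder, inner sums)]
-/

noncomputable section

open Real MeasureTheory Finset

namespace Summit.Parity.GeneralizedHardyLittlewood.Theorems.MomentsBeyondDiagonal.DiagCorner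

open Summit.Parity.GeneralizedHardyLittlewood.Theorems.BeyondDiagonalBeatsQuarter.Corner
open Summit.Parity.GeneralizedHardyLittlewood.Theorems.MomentsBeyondDiagonal.DiagLines

/-- Monotonicity of the two-sequence envelope from exponent `6` to exponent `8` (`1 ≤ x`, `C' ≤ C`). [folklore] -/
theorem twoSeq_envelope_mono68 {S₁ S₂ B η Li Lj s x C' C v : ℝ} (hS₁ : 0 ≤ S₁) (hS₂ : 0 ≤ S₂) (hB : 0 ≤ B) (hη : 0 ≤ η)
    (hLi : 0 ≤ Li) (hLj : 0 ≤ Lj) (hs : 0 ≤ s) (hx : 1 ≤ x) (hC'0 : 0 ≤ C') (hC : C' ≤ C)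
    (hv : v ≤ S₁ * (B * (Lj * (3 * C' * s))) + S₂ * ((2 * η) * (Li * (9 * C' * x ^ 6)))) :
    v ≤ S₁ * (B * (Lj * (3 * C * s))) + S₂ * ((2 * η) * (Li * (9 * C * x ^ 8))) := by
  have hx0 : 0 ≤ x := zero_le_one.trans hx
  have hx8 : 0 ≤ x ^ 8 := pow_nonneg hx0 8
  have hx68 : x ^ 6 ≤ x ^ 8 := pow_le_pow_right₀ hx (by norm_num)
  have e1 : 3 * C' * s ≤ 3 * C * s := by nlinarith
  have e2 : 9 * C' * x ^ 6 ≤ 9 * C * x ^ 8 := by nlinarith [mul_le_mul_of_nonneg_left hx68 hC'0]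
  refine hv.trans (add_le_add ?_ ?_)
  · exact mul_le_mul_of_nonneg_left (mul_le_mul_of_nonneg_left (mul_le_mul_of_nonneg_left e1 hLj) hB) hS₁
  · exact mul_le_mul_of_nonneg_left (mul_le_mul_of_nonneg_left (mul_le_mul_of_nonneg_left e2 hLi)
      (by positivity)) hS₂

set_option maxHeartbeats 3200000 in
-- fifteen kernels, large statement
/-- **All fifteen remainder kernels of order `(2,4)` under one constant, with the pointwise bounds of the six both-sided ones**
(module docstring). [cite: KowalskiMichelVanderKam2000, (23)–(28) and Prop. 5.1 — derivation (order-(2,4) remainder, inner sums)] -/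
theorem twoSeq_fifteen₂₄ : ∃ E₀₀ E₀₁ E₀₂ E₀₃ E₀₄ E₁₀ E₁₁ E₁₂ E₁₃ E₁₄ E₂₀ E₂₁ E₂₂ E₂₃ E₂₄ C₀ : ℝ, 0 ≤ C₀ ∧
    (∀ R : ℝ → ℝ,
      (R = (fun y : ℝ ↦ ((∫ u₁ in Set.Ioi (0 : ℝ), ∫ u₂ in Set.Ioi (y / u₁),
              Real.exp (-(u₁ + u₂)) / (1 - Real.exp (-(u₁ + u₂))) ^ 2) -
            (Real.log (1 / y) / 2 + E₀₀))) ∨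
       R = (fun y : ℝ ↦ ((∫ u₁ in Set.Ioi (0 : ℝ), ∫ u₂ in Set.Ioi (y / u₁),
              Real.exp (-(u₁ + u₂)) / (1 - Real.exp (-(u₁ + u₂))) ^ 2 * Real.log u₂) -
            (-(Real.log (1 / y) ^ 2) / 8 + E₀₁))) ∨
       R = (fun y : ℝ ↦ ((∫ u₁ in Set.Ioi (0 : ℝ), ∫ u₂ in Set.Ioi (y / u₁),
              Real.exp (-(u₁ + u₂)) / (1 - Real.exp (-(u₁ + u₂))) ^ 2 * Real.log u₂ ^ 2) -
            (Real.log (1 / y) ^ 3 / 24 + 2 * (∫ v in Set.Ioc (0 : ℝ) 1, Real.log v ^ 2 * (v / (1 + v ^ 2) ^ 2)) * Real.log (1 / y) + E₀₂))) ∨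
       R = (fun y : ℝ ↦ ((∫ u₁ in Set.Ioi (0 : ℝ), ∫ u₂ in Set.Ioi (y / u₁),
              Real.exp (-(u₁ + u₂)) / (1 - Real.exp (-(u₁ + u₂))) ^ 2 * Real.log u₂ ^ 3) -
            (-(Real.log (1 / y) ^ 4) / 64 - 3 * (∫ v in Set.Ioc (0 : ℝ) 1, Real.log v ^ 2 * (v / (1 + v ^ 2) ^ 2)) / 2 * Real.log (1 / y) ^ 2 + E₀₃))) ∨
       R = (fun y : ℝ ↦ ((∫ u₁ in Set.Ioi (0 : ℝ), ∫ u₂ in Set.Ioi (y / u₁),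
              Real.exp (-(u₁ + u₂)) / (1 - Real.exp (-(u₁ + u₂))) ^ 2 * Real.log u₂ ^ 4) -
            (Real.log (1 / y) ^ 5 / 160 + (∫ v in Set.Ioc (0 : ℝ) 1, Real.log v ^ 2 * (v / (1 + v ^ 2) ^ 2)) * Real.log (1 / y) ^ 3 + 2 * (∫ v in Set.Ioc (0 : ℝ) 1, Real.log v ^ 4 * (v / (1 + v ^ 2) ^ 2)) * Real.log (1 / y) + E₀₄))) ∨
       R = (fun y : ℝ ↦ ((∫ u₁ in Set.Ioi (0 : ℝ), Real.log u₁ * ∫ u₂ in Set.Ioi (y / u₁),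
              Real.exp (-(u₁ + u₂)) / (1 - Real.exp (-(u₁ + u₂))) ^ 2) -
            (-(Real.log (1 / y) ^ 2) / 8 + E₁₀))) ∨
       R = (fun y : ℝ ↦ ((∫ u₁ in Set.Ioi (0 : ℝ), Real.log u₁ * ∫ u₂ in Set.Ioi (y / u₁),
              Real.exp (-(u₁ + u₂)) / (1 - Real.exp (-(u₁ + u₂))) ^ 2 * Real.log u₂) -
            (Real.log (1 / y) ^ 3 / 24 - 2 * (∫ v in Set.Ioc (0 : ℝ) 1, Real.log v ^ 2 * (v / (1 + v ^ 2) ^ 2)) * Real.log (1 / y) + E₁₁))) ∨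
       R = (fun y : ℝ ↦ ((∫ u₁ in Set.Ioi (0 : ℝ), Real.log u₁ * ∫ u₂ in Set.Ioi (y / u₁),
              Real.exp (-(u₁ + u₂)) / (1 - Real.exp (-(u₁ + u₂))) ^ 2 * Real.log u₂ ^ 2) -
            (-(Real.log (1 / y) ^ 4) / 64 + (∫ v in Set.Ioc (0 : ℝ) 1, Real.log v ^ 2 * (v / (1 + v ^ 2) ^ 2)) / 2 * Real.log (1 / y) ^ 2 + E₁₂))) ∨
       R = (fun y : ℝ ↦ ((∫ u₁ in Set.Ioi (0 : ℝ), Real.log u₁ * ∫ u₂ in Set.Ioi (y / u₁),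
              Real.exp (-(u₁ + u₂)) / (1 - Real.exp (-(u₁ + u₂))) ^ 2 * Real.log u₂ ^ 3) -
            (Real.log (1 / y) ^ 5 / 160 - 2 * (∫ v in Set.Ioc (0 : ℝ) 1, Real.log v ^ 4 * (v / (1 + v ^ 2) ^ 2)) * Real.log (1 / y) + E₁₃))) ∨
       R = (fun y : ℝ ↦ ((∫ u₁ in Set.Ioi (0 : ℝ), Real.log u₁ * ∫ u₂ in Set.Ioi (y / u₁),
              Real.exp (-(u₁ + u₂)) / (1 - Real.exp (-(u₁ + u₂))) ^ 2 * Real.log u₂ ^ 4) -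
            (-(Real.log (1 / y) ^ 6) / 384 - (∫ v in Set.Ioc (0 : ℝ) 1, Real.log v ^ 2 * (v / (1 + v ^ 2) ^ 2)) / 8 * Real.log (1 / y) ^ 4 + 3 * (∫ v in Set.Ioc (0 : ℝ) 1, Real.log v ^ 4 * (v / (1 + v ^ 2) ^ 2)) / 2 * Real.log (1 / y) ^ 2 + E₁₄))) ∨
       R = (fun y : ℝ ↦ ((∫ u₁ in Set.Ioi (0 : ℝ), Real.log u₁ ^ 2 * ∫ u₂ in Set.Ioi (y / u₁),
              Real.exp (-(u₁ + u₂)) / (1 - Real.exp (-(u₁ + u₂))) ^ 2) -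
            (Real.log (1 / y) ^ 3 / 24 + 2 * (∫ v in Set.Ioc (0 : ℝ) 1, Real.log v ^ 2 * (v / (1 + v ^ 2) ^ 2)) * Real.log (1 / y) + E₂₀))) ∨
       R = (fun y : ℝ ↦ ((∫ u₁ in Set.Ioi (0 : ℝ), Real.log u₁ ^ 2 * ∫ u₂ in Set.Ioi (y / u₁),
              Real.exp (-(u₁ + u₂)) / (1 - Real.exp (-(u₁ + u₂))) ^ 2 * Real.log u₂) -
            (-(Real.log (1 / y) ^ 4) / 64 + (∫ v in Set.Ioc (0 : ℝ) 1, Real.log v ^ 2 * (v / (1 + v ^ 2) ^ 2)) / 2 * Real.log (1 / y) ^ 2 + E₂₁))) ∨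
       R = (fun y : ℝ ↦ ((∫ u₁ in Set.Ioi (0 : ℝ), Real.log u₁ ^ 2 * ∫ u₂ in Set.Ioi (y / u₁),
              Real.exp (-(u₁ + u₂)) / (1 - Real.exp (-(u₁ + u₂))) ^ 2 * Real.log u₂ ^ 2) -
            (Real.log (1 / y) ^ 5 / 160 - (∫ v in Set.Ioc (0 : ℝ) 1, Real.log v ^ 2 * (v / (1 + v ^ 2) ^ 2)) / 3 * Real.log (1 / y) ^ 3 + 2 * (∫ v in Set.Ioc (0 : ℝ) 1, Real.log v ^ 4 * (v / (1 + v ^ 2) ^ 2)) * Real.log (1 / y) + E₂₂))) ∨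
       R = (fun y : ℝ ↦ ((∫ u₁ in Set.Ioi (0 : ℝ), Real.log u₁ ^ 2 * ∫ u₂ in Set.Ioi (y / u₁),
              Real.exp (-(u₁ + u₂)) / (1 - Real.exp (-(u₁ + u₂))) ^ 2 * Real.log u₂ ^ 3) -
            (-(Real.log (1 / y) ^ 6) / 384 + (∫ v in Set.Ioc (0 : ℝ) 1, Real.log v ^ 2 * (v / (1 + v ^ 2) ^ 2)) / 8 * Real.log (1 / y) ^ 4 - (∫ v in Set.Ioc (0 : ℝ) 1, Real.log v ^ 4 * (v / (1 + v ^ 2) ^ 2)) / 2 * Real.log (1 / y) ^ 2 + E₂₃))) ∨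
       R = (fun y : ℝ ↦ ((∫ u₁ in Set.Ioi (0 : ℝ), Real.log u₁ ^ 2 * ∫ u₂ in Set.Ioi (y / u₁),
              Real.exp (-(u₁ + u₂)) / (1 - Real.exp (-(u₁ + u₂))) ^ 2 * Real.log u₂ ^ 4) -
            (Real.log (1 / y) ^ 7 / 896 - (∫ v in Set.Ioc (0 : ℝ) 1, Real.log v ^ 2 * (v / (1 + v ^ 2) ^ 2)) / 40 * Real.log (1 / y) ^ 5 - (∫ v in Set.Ioc (0 : ℝ) 1, Real.log v ^ 4 * (v / (1 + v ^ 2) ^ 2)) / 6 * Real.log (1 / y) ^ 3 + 2 * (∫ v in Set.Ioc (0 : ℝ) 1, Real.log v ^ 6 * (v / (1 + v ^ 2) ^ 2)) * Real.log (1 / y) + E₂₄)))) →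
      ∀ (a₁ a₂ : ℕ → ℝ) (Y α B η : ℝ) (K₁ i j : ℕ), 1 ≤ Y → 0 < α → 1 ≤ i → 1 ≤ j →
        (∀ e : ℕ, e ≤ ⌊Y⌋₊ → |∑ k ∈ Icc 1 e, a₂ k| ≤ B) → (∀ e : ℕ, K₁ ≤ e → |∑ k ∈ Icc 1 e, a₁ k| ≤ η) →
        2 * α * K₁ * Y ≤ 1 →
      |∑ k₁ ∈ Icc 1 ⌊Y⌋₊, ∑ k₂ ∈ Icc 1 ⌊Y⌋₊,
          a₁ k₁ * a₂ k₂ * ellp Y k₁ ^ i * ellp Y k₂ ^ j * R (α * k₁ * k₂)| ≤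
        (∑ k ∈ Icc 1 ⌊Y⌋₊, |a₁ k| * ellp Y k ^ i) * (B * (Real.log Y ^ j * (3 * C₀ * Real.sqrt (2 * α * K₁ * Y)))) +
        (∑ k ∈ Icc 1 ⌊Y⌋₊, |a₂ k| * ellp Y k ^ j) *
          ((2 * η) * (Real.log Y ^ i * (9 * C₀ * (1 + |Real.log (2 * α * Y ^ 2)|) ^ 8)))) ∧
    (∀ R : ℝ → ℝ,
      (R = (fun y : ℝ ↦ (∫ u₁ in Set.Ioi (0 : ℝ), ∫ u₂ in Set.Ioi (y / u₁),
              Real.exp (-(u₁ + u₂)) / (1 - Real.exp (-(u₁ + u₂))) ^ 2) -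
            (Real.log (1 / y) / 2 + E₀₀)) ∨
       R = (fun y : ℝ ↦ (∫ u₁ in Set.Ioi (0 : ℝ), ∫ u₂ in Set.Ioi (y / u₁),
              Real.exp (-(u₁ + u₂)) / (1 - Real.exp (-(u₁ + u₂))) ^ 2 * Real.log u₂) -
            (-(Real.log (1 / y) ^ 2) / 8 + E₀₁)) ∨
       R = (fun y : ℝ ↦ (∫ u₁ in Set.Ioi (0 : ℝ), Real.log u₁ * ∫ u₂ in Set.Ioi (y / u₁),
              Real.exp (-(u₁ + u₂)) / (1 - Real.exp (-(u₁ + u₂))) ^ 2) -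
            (-(Real.log (1 / y) ^ 2) / 8 + E₁₀)) ∨
       R = (fun y : ℝ ↦ (∫ u₁ in Set.Ioi (0 : ℝ), ∫ u₂ in Set.Ioi (y / u₁),
              Real.exp (-(u₁ + u₂)) / (1 - Real.exp (-(u₁ + u₂))) ^ 2 * Real.log u₂ ^ 2) -
            (Real.log (1 / y) ^ 3 / 24 + 2 * (∫ v in Set.Ioc (0 : ℝ) 1, Real.log v ^ 2 * (v / (1 + v ^ 2) ^ 2)) * Real.log (1 / y) + E₀₂)) ∨
       R = (fun y : ℝ ↦ (∫ u₁ in Set.Ioi (0 : ℝ), Real.log u₁ ^ 2 * ∫ u₂ in Set.Ioi (y / u₁),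
              Real.exp (-(u₁ + u₂)) / (1 - Real.exp (-(u₁ + u₂))) ^ 2) -
            (Real.log (1 / y) ^ 3 / 24 + 2 * (∫ v in Set.Ioc (0 : ℝ) 1, Real.log v ^ 2 * (v / (1 + v ^ 2) ^ 2)) * Real.log (1 / y) + E₂₀)) ∨
       R = (fun y : ℝ ↦ (∫ u₁ in Set.Ioi (0 : ℝ), Real.log u₁ * ∫ u₂ in Set.Ioi (y / u₁),
              Real.exp (-(u₁ + u₂)) / (1 - Real.exp (-(u₁ + u₂))) ^ 2 * Real.log u₂) -
            (Real.log (1 / y) ^ 3 / 24 - 2 * (∫ v in Set.Ioc (0 : ℝ) 1, Real.log v ^ 2 * (v / (1 + v ^ 2) ^ 2)) * Real.log (1 / y) + E₁₁))) →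
      (∀ y : ℝ, 0 < y → y ≤ 1 → |R y| ≤ C₀ * Real.sqrt y) ∧ (∀ y : ℝ, 1 ≤ y → |R y| ≤ C₀ * (1 + Real.log y) ^ 3)) := by
  obtain ⟨E₀₀, E₀₁, E₀₂, E₀₃, E₁₀, E₁₁, E₁₂, E₁₃, E₂₀, E₂₁, E₂₂, E₂₃, E₃₀, E₃₁, E₃₂, E₃₃, C₀a, hC₀a, hTa, hPW⟩ :=
    twoSeq_sixteen₃₃
  obtain ⟨E₀₄, C₀b, hC₀b, hTb⟩ := abs_doubleSum_rem_le₀₄b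
  obtain ⟨E₁₄, E₂₄, C₀c, hC₀c, hTc⟩ := abs_doubleSum_rem_le₂₄b
  set C₀ : ℝ := max (max C₀a C₀b) C₀c with hC₀def
  have ea : C₀a ≤ C₀ := (le_max_left _ _).trans (le_max_left _ _)
  have eb : C₀b ≤ C₀ := (le_max_right _ _).trans (le_max_left _ _)
  have ec : C₀c ≤ C₀ := le_max_right _ _
  have hC₀ : 0 ≤ C₀ := hC₀a.trans ea
  refine ⟨E₀₀, E₀₁, E₀₂, E₀₃, E₀₄, E₁₀, E₁₁, E₁₂, E₁₃, E₁₄, E₂₀, E₂₁, E₂₂, E₂₃, E₂₄, C₀, hC₀, ?_, ?_⟩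
  · intro R hRR a₁ a₂ Y α B η K₁ i j hY hα hi hj hcol hrow hY₁
    have hLY0 : 0 ≤ Real.log Y := Real.log_nonneg hY
    have hB0 : 0 ≤ B := (abs_nonneg _).trans (hcol 0 (Nat.zero_le _))
    have hη0 : 0 ≤ η := (abs_nonneg _).trans (hrow K₁ le_rfl)
    have hS₁ : 0 ≤ ∑ k ∈ Icc 1 ⌊Y⌋₊, |a₁ k| * ellp Y k ^ i :=
      Finset.sum_nonneg fun k _ ↦ mul_nonneg (abs_nonneg _) (pow_nonneg (ellp_nonneg Y k) i)
    have hS₂ : 0 ≤ ∑ k ∈ Icc 1 ⌊Y⌋₊, |a₂ k| * ellp Y k ^ j :=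
      Finset.sum_nonneg fun k _ ↦ mul_nonneg (abs_nonneg _) (pow_nonneg (ellp_nonneg Y k) j)
    have hLi : 0 ≤ Real.log Y ^ i := pow_nonneg hLY0 i
    have hLj : 0 ≤ Real.log Y ^ j := pow_nonneg hLY0 j
    have hs0 : 0 ≤ Real.sqrt (2 * α * K₁ * Y) := Real.sqrt_nonneg _
    have hx0 : 0 ≤ 1 + |Real.log (2 * α * Y ^ 2)| := by positivity
    have hx1 : 1 ≤ 1 + |Real.log (2 * α * Y ^ 2)| := by linarith [abs_nonneg (Real.log (2 * α * Y ^ 2))]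
    rcases hRR with h | h | h | h | h | h | h | h | h | h | h | h | h | h | h
    · exact twoSeq_envelope_mono8 hS₁ hS₂ hB0 hη0 hLi hLj hs0 hx0 ea
        (hTa R (Or.inl h) a₁ a₂ Y α B η K₁ i j hY hα hi hj hcol hrow hY₁)
    · exact twoSeq_envelope_mono8 hS₁ hS₂ hB0 hη0 hLi hLj hs0 hx0 ea
        (hTa R (Or.inr (Or.inl h)) a₁ a₂ Y α B η K₁ i j hY hα hi hj hcol hrow hY₁)
    · exact twoSeq_envelope_mono8 hS₁ hS₂ hB0 hη0 hLi hLj hs0 hx0 ea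
        (hTa R (Or.inr (Or.inr (Or.inl h))) a₁ a₂ Y α B η K₁ i j hY hα hi hj hcol hrow hY₁)
    · exact twoSeq_envelope_mono8 hS₁ hS₂ hB0 hη0 hLi hLj hs0 hx0 ea
        (hTa R (Or.inr (Or.inr (Or.inr (Or.inl h)))) a₁ a₂ Y α B η K₁ i j hY hα hi hj hcol hrow hY₁)
    · subst h
      exact twoSeq_envelope_mono68 hS₁ hS₂ hB0 hη0 hLi hLj hs0 hx1 hC₀b eb
        (hTb a₁ a₂ Y α B η K₁ i j hY hα hi hj hcol hrow hY₁)
    · exact twoSeq_envelope_mono8 hS₁ hS₂ hB0 hη0 hLi hLj hs0 hx0 ea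
        (hTa R (Or.inr (Or.inr (Or.inr (Or.inr (Or.inl h))))) a₁ a₂ Y α B η K₁ i j hY hα hi hj hcol hrow hY₁)
    · exact twoSeq_envelope_mono8 hS₁ hS₂ hB0 hη0 hLi hLj hs0 hx0 ea
        (hTa R (Or.inr (Or.inr (Or.inr (Or.inr (Or.inr (Or.inl h)))))) a₁ a₂ Y α B η K₁ i j hY hα hi hj hcol hrow hY₁)
    · exact twoSeq_envelope_mono8 hS₁ hS₂ hB0 hη0 hLi hLj hs0 hx0 ea
        (hTa R (Or.inr (Or.inr (Or.inr (Or.inr (Or.inr (Or.inr (Or.inl h))))))) a₁ a₂ Y α B η K₁ i j hY hα hi hj hcol hrow hY₁)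
    · exact twoSeq_envelope_mono8 hS₁ hS₂ hB0 hη0 hLi hLj hs0 hx0 ea
        (hTa R (Or.inr (Or.inr (Or.inr (Or.inr (Or.inr (Or.inr (Or.inr (Or.inl h)))))))) a₁ a₂ Y α B η K₁ i j hY hα hi hj hcol hrow hY₁)
    · subst h
      exact twoSeq_envelope_mono8 hS₁ hS₂ hB0 hη0 hLi hLj hs0 hx0 ec
        (hTc a₁ a₂ Y α B η K₁ i j hY hα hi hj hcol hrow hY₁).1
    · exact twoSeq_envelope_mono8 hS₁ hS₂ hB0 hη0 hLi hLj hs0 hx0 ea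
        (hTa R (Or.inr (Or.inr (Or.inr (Or.inr (Or.inr (Or.inr (Or.inr (Or.inr (Or.inl h))))))))) a₁ a₂ Y α B η K₁ i j hY hα hi hj hcol hrow hY₁)
    · exact twoSeq_envelope_mono8 hS₁ hS₂ hB0 hη0 hLi hLj hs0 hx0 ea
        (hTa R (Or.inr (Or.inr (Or.inr (Or.inr (Or.inr (Or.inr (Or.inr (Or.inr (Or.inr (Or.inl h)))))))))) a₁ a₂ Y α B η K₁ i j hY hα hi hj hcol hrow hY₁)
    · exact twoSeq_envelope_mono8 hS₁ hS₂ hB0 hη0 hLi hLj hs0 hx0 ea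
        (hTa R (Or.inr (Or.inr (Or.inr (Or.inr (Or.inr (Or.inr (Or.inr (Or.inr (Or.inr (Or.inr (Or.inl h))))))))))) a₁ a₂ Y α B η K₁ i j hY hα hi hj hcol hrow hY₁)
    · exact twoSeq_envelope_mono8 hS₁ hS₂ hB0 hη0 hLi hLj hs0 hx0 ea
        (hTa R (Or.inr (Or.inr (Or.inr (Or.inr (Or.inr (Or.inr (Or.inr (Or.inr (Or.inr (Or.inr (Or.inr (Or.inl h)))))))))))) a₁ a₂ Y α B η K₁ i j hY hα hi hj hcol hrow hY₁)
    · subst h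
      exact twoSeq_envelope_mono8 hS₁ hS₂ hB0 hη0 hLi hLj hs0 hx0 ec
        (hTc a₁ a₂ Y α B η K₁ i j hY hα hi hj hcol hrow hY₁).2
  · intro R hRR
    rcases hRR with h | h | h | h | h | h
    · obtain ⟨h1, h2⟩ := hPW R (Or.inl h)
      exact ⟨fun y hy0 hy1 ↦ (h1 y hy0 hy1).trans (mul_le_mul_of_nonneg_right ea (Real.sqrt_nonneg y)),
        fun y hy ↦ (h2 y hy).trans (mul_le_mul_of_nonneg_right ea (pow_nonneg (by linarith [Real.log_nonneg hy]) _))⟩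
    · obtain ⟨h1, h2⟩ := hPW R (Or.inr (Or.inl h))
      exact ⟨fun y hy0 hy1 ↦ (h1 y hy0 hy1).trans (mul_le_mul_of_nonneg_right ea (Real.sqrt_nonneg y)),
        fun y hy ↦ (h2 y hy).trans (mul_le_mul_of_nonneg_right ea (pow_nonneg (by linarith [Real.log_nonneg hy]) _))⟩
    · obtain ⟨h1, h2⟩ := hPW R (Or.inr (Or.inr (Or.inl h)))
      exact ⟨fun y hy0 hy1 ↦ (h1 y hy0 hy1).trans (mul_le_mul_of_nonneg_right ea (Real.sqrt_nonneg y)),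
        fun y hy ↦ (h2 y hy).trans (mul_le_mul_of_nonneg_right ea (pow_nonneg (by linarith [Real.log_nonneg hy]) _))⟩
    · obtain ⟨h1, h2⟩ := hPW R (Or.inr (Or.inr (Or.inr (Or.inl h))))
      exact ⟨fun y hy0 hy1 ↦ (h1 y hy0 hy1).trans (mul_le_mul_of_nonneg_right ea (Real.sqrt_nonneg y)),
        fun y hy ↦ (h2 y hy).trans (mul_le_mul_of_nonneg_right ea (pow_nonneg (by linarith [Real.log_nonneg hy]) _))⟩
    · obtain ⟨h1, h2⟩ := hPW R (Or.inr (Or.inr (Or.inr (Or.inr (Or.inl h)))))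
      exact ⟨fun y hy0 hy1 ↦ (h1 y hy0 hy1).trans (mul_le_mul_of_nonneg_right ea (Real.sqrt_nonneg y)),
        fun y hy ↦ (h2 y hy).trans (mul_le_mul_of_nonneg_right ea (pow_nonneg (by linarith [Real.log_nonneg hy]) _))⟩
    · obtain ⟨h1, h2⟩ := hPW R (Or.inr (Or.inr (Or.inr (Or.inr (Or.inr h)))))
      exact ⟨fun y hy0 hy1 ↦ (h1 y hy0 hy1).trans (mul_le_mul_of_nonneg_right ea (Real.sqrt_nonneg y)),
        fun y hy ↦ (h2 y hy).trans (mul_le_mul_of_nonneg_right ea (pow_nonneg (by linarith [Real.log_nonneg hy]) _))⟩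

end Summit.Parity.GeneralizedHardyLittlewood.Theorems.MomentsBeyondDiagonal.DiagCorner

end
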